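import Summits.Ventures.HSemireg.UntwistCocycleTwistDualHomNaturality
import Summits.Ventures.HSemireg.UntwistCocycleTwistDualHomTrace
import Summits.Ventures.HSemireg.UntwistCocycleTwistLeibnizCocycle
import Literature.AlgebraicGeometry.HodgeTheory.SemiregularityHigherSigma
import HarnessLib

/-!
# Venture HSemireg — route R1.0, untwisted reading: the level-`j` jet comparison
# `J^j_x : Pʲ(E)| ⟶ Pʲ(E⟨c⟩)|` and the local inverse of `λ_j` (gs-g4; row `q ≥ 2` input (J2) of
# `general-structure/LEIBNIZ-ROW2-PLAN-gs-g4.md` §5)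

HONEST FRAMING. Module-level sheaf algebra on the tree's REAL carriers: the `Ωʲ`-twisted jet modules
`Pʲ(E) = twistJetModule E j` of `HodgeTheory/SemiregularityHigherSigma.lean` (pairs `(φ, ψ)`, `φ ∈ E ⊗ Ωʲ`,
`ψ ∈ E ⊗ Ωʲ⁺¹`, `a • (φ, ψ) = (a φ, a ψ + da ∧ φ)`), th-4's cocycle twist `E⟨c⟩ = E ⊗ M` and the comparisons
`λ_j = CocycleTwist.dualHomTwist c E Ωʲ : (E ⊗ Ωʲ)⟨c⟩ → E⟨c⟩ ⊗ Ωʲ`. Nothing about any variety; no gerbe; nothing here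
says HC, HC_CM or HC_AV is proved.

* `jetTwistOverHigher c E j x W` (`J^j_x`) — **`Pʲ(E)|_W ⟶ Pʲ(E⟨c⟩)|_W` over `W ⊆ U_x`,
  `(φ, ψ) ↦ (λ_j(φ ⊗ t_x), λ_{j+1}(ψ ⊗ t_x))`**, `𝒪`-linear for the twisted structures because
  `λ_{j+1}((da ∧ φ) ⊗ t_x) = da ∧ λ_j(φ ⊗ t_x)` (`dualHomTwist_app_trivSection_comp`: `da ∧ –` is post-composition
  with the local map `(∧)| ≫ ev_{da}`, `wedgeD_eq_comp_wedgeHomAt`);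
* `dualHomLocal c E j x W` (`κ′_x = λ_j ∘ (– ⊗ t_x)`) and `dualHomLocalInv` (`κ_x`), the LOCAL INVERSE of `λ_j`
  over `W ⊆ U_x`, both as iterated pre-compositions (`precompOver`) with `t_x^{±1}` on the dual:
  `appLE_dualHomLocal` (`κ′_x φ = λ_j(φ ⊗ t_x)`), `dualHomLocalInv_comp_dualHomLocal`, `dualHomLocal_comp_dualHomLocalInv`
  (`= 𝟙`), and `dualHomLocal_comp_dualHomLocalInv_eq_smul` (`κ_y(κ′_x φ) = g_{yx} φ`) — the level-`j` replacement of
  `t_x⁻¹` in the transported splittings of `UntwistCocycleTwistLeibnizCocycle` (there the right ends of the two jet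
  sequences coincide; at level `j` they differ by `λ_j`).

Which Ext groups: none (sections only); which twist: `- ⊗ M_B`, `M_B = lineBundle c`.

## References

* M. F. Atiyah, *Complex analytic connections in fibre bundles*, Trans. AMS 85 (1957), §4, Prop. 10. [Atiyah1957]
* R.-O. Buchweitz, H. Flenner, Compositio Math. 137 (2003), §3 (Atiyah class, `At^k`). [BuchweitzFlenner2003]
* R. Hartshorne, *Algebraic Geometry* (1977), II Ex. 5.1 (b). [Hartshorne1977]
-/

noncomputable section

open CategoryTheory AlgebraicGeometry Opposite TopologicalSpace

namespace Summit.Ventures.HSemireg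

namespace CocycleTwist

open Literature.AlgebraicGeometry.Modules Literature.AlgebraicGeometry.Motives
  Literature.AlgebraicGeometry.HodgeTheory

universe u

variable {S : Type u} [CommRing S] {X : Over (Spec (CommRingCat.of S))} (c : UnitCocycle X.left)
  (E : X.left.Modules) (j : ℕ)

/-! ### `da ∧ –` is post-composition with a local morphism -/

/-- The local morphism `ω ↦ η ∧ ω : Ωʲ|_V → Ωʲ⁺¹|_V` for a `1`-form `η ∈ Γ(Ω¹, V)` (`(∧)| ≫ ev_η`). [folklore] -/
def wedgeHomAt {V : X.left.Opens} (η : Γ(cotangentSheaf X, V)) :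
    (hodgeSheaf X j).over V ⟶ (hodgeSheaf X (j + 1)).over V :=
  (SheafOfModules.overFunctor _ V).map (wedgeSheafHom X j) ≫ evalAt (M := hodgeSheaf X (j + 1)) η

/-- `da ∧ φ = φ ≫ (da ∧ –)`. [folklore] -/
theorem wedgeD_eq_comp_wedgeHomAt (F : X.left.Modules) {V : X.left.Opens} (a : Γ(X.left, V))
    (φ : (dual F).over V ⟶ (hodgeSheaf X j).over V) :
    wedgeD F j V a φ = φ ≫ wedgeHomAt j (dSection X V a) := rfl

variable {G G' : X.left.Modules} in
/-- `λ_{G'}((φ ≫ t) ⊗ t_x) = λ_G(φ ⊗ t_x) ≫ t` for a local morphism `t` over the SAME open (`UntwistCocycleTwistDualHomNaturality`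
with `k = 𝟙`). [folklore] -/
theorem dualHomTwist_app_trivSection_comp_id (x : X.left) {V : X.left.Opens} (hV : V ≤ c.U x)
    (t : G.over V ⟶ G'.over V) (φ : (dual E).over V ⟶ G.over V) :
    ((dualHomTwist c E G').app V (trivSection c (sheafHom (dual E) G') x hV ((φ ≫ t : (dual E).over V ⟶ G'.over V))) :
        (dual (twist c E)).over V ⟶ G'.over V) =
      ((dualHomTwist c E G).app V (trivSection c (sheafHom (dual E) G) x hV φ) : (dual (twist c E)).over V ⟶ G.over V) ≫ t := by
  have h := dualHomTwist_app_trivSection_comp c E x (𝟙 V) hV t φ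
  rwa [restrictHom_id'] at h

/-! ### `J^j_x : Pʲ(E)|_W ⟶ Pʲ(E⟨c⟩)|_W` -/

section Jet

variable (x : X.left) (W : X.left.Opens) (hW : W ≤ c.U x)

/-- The map on twisted jet sections over `V ⊆ W ⊆ U_x`: `(φ, ψ) ↦ (λ_j(φ ⊗ t_x), λ_{j+1}(ψ ⊗ t_x))`. [folklore] -/
def jetTwistFunHigher {V : X.left.Opens} (hV : V ≤ c.U x) (p : TwistJetSections E j V) :
    TwistJetSections (twist c E) j V :=
  TwistJetSections.mk
    ((dualHomTwist c E (hodgeSheaf X j)).app V (trivSection c (twistHodge E j) x hV p.fst) :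
      (dual (twist c E)).over V ⟶ (hodgeSheaf X j).over V)
    ((dualHomTwist c E (hodgeSheaf X (j + 1))).app V (trivSection c (twistHodge E (j + 1)) x hV p.snd) :
      (dual (twist c E)).over V ⟶ (hodgeSheaf X (j + 1)).over V)

/-- First component of `J^j_x(p)`. [folklore] -/
@[simp]
theorem jetTwistFunHigher_fst {V : X.left.Opens} (hV : V ≤ c.U x) (p : TwistJetSections E j V) :
    (jetTwistFunHigher c E j x hV p).fst =
      ((dualHomTwist c E (hodgeSheaf X j)).app V (trivSection c (twistHodge E j) x hV p.fst) :
        (dual (twist c E)).over V ⟶ (hodgeSheaf X j).over V) := rfl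

/-- Second component of `J^j_x(p)`. [folklore] -/
@[simp]
theorem jetTwistFunHigher_snd {V : X.left.Opens} (hV : V ≤ c.U x) (p : TwistJetSections E j V) :
    (jetTwistFunHigher c E j x hV p).snd =
      ((dualHomTwist c E (hodgeSheaf X (j + 1))).app V (trivSection c (twistHodge E (j + 1)) x hV p.snd) :
        (dual (twist c E)).over V ⟶ (hodgeSheaf X (j + 1)).over V) := rfl

/-- `J^j_x` is additive. [folklore] -/
theorem jetTwistFunHigher_add {V : X.left.Opens} (hV : V ≤ c.U x) (p q : TwistJetSections E j V) :
    jetTwistFunHigher c E j x hV (p + q) = jetTwistFunHigher c E j x hV p + jetTwistFunHigher c E j x hV q := by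
  refine TwistJetSections.ext ?_ ?_
  · rw [jetTwistFunHigher_fst, TwistJetSections.fst_add, TwistJetSections.fst_add, jetTwistFunHigher_fst,
      jetTwistFunHigher_fst, trivSection_add_hom, map_add]
    rfl
  · rw [jetTwistFunHigher_snd, TwistJetSections.snd_add, TwistJetSections.snd_add, jetTwistFunHigher_snd,
      jetTwistFunHigher_snd, trivSection_add_hom, map_add]
    rfl

/-- `J^j_x(0) = 0`. [folklore] -/
theorem jetTwistFunHigher_zero {V : X.left.Opens} (hV : V ≤ c.U x) :
    jetTwistFunHigher c E j x hV (0 : TwistJetSections E j V) = 0 := by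
  have h := jetTwistFunHigher_add c E j x hV (0 : TwistJetSections E j V) 0
  rw [add_zero] at h
  exact left_eq_add.mp h

/-- **`J^j_x` is `𝒪_X`-linear for the twisted structures** (`λ_{j+1}((da ∧ φ) ⊗ t_x) = da ∧ λ_j(φ ⊗ t_x)`).
[cite: Atiyah1957, §4] -/
theorem jetTwistFunHigher_smul {V : X.left.Opens} (hV : V ≤ c.U x) (a : Γ(X.left, V)) (p : TwistJetSections E j V) :
    jetTwistFunHigher c E j x hV (a • p) = a • jetTwistFunHigher c E j x hV p := by
  refine TwistJetSections.ext ?_ ?_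
  · rw [jetTwistFunHigher_fst, TwistJetSections.fst_smul, TwistJetSections.fst_smul, jetTwistFunHigher_fst,
      trivSection_smul_hom, Scheme.Modules.Hom.app_smul]
    rfl
  · rw [jetTwistFunHigher_snd, TwistJetSections.snd_smul, TwistJetSections.snd_smul, jetTwistFunHigher_snd,
      jetTwistFunHigher_fst, trivSection_add_hom, map_add, trivSection_smul_hom, Scheme.Modules.Hom.app_smul,
      wedgeD_eq_comp_wedgeHomAt, wedgeD_eq_comp_wedgeHomAt, dualHomTwist_app_trivSection_comp_id]
    rfl

/-- `J^j_x` commutes with restriction. [folklore] -/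
theorem jetTwistFunHigher_restrict {V V' : X.left.Opens} (hV : V ≤ c.U x) (i : V' ⟶ V) (p : TwistJetSections E j V) :
    jetTwistFunHigher c E j x (i.le.trans hV) (TwistJetSections.restrict i p) =
      TwistJetSections.restrict i (jetTwistFunHigher c E j x hV p) := by
  refine TwistJetSections.ext ?_ ?_
  · rw [jetTwistFunHigher_fst, TwistJetSections.fst_restrict, TwistJetSections.fst_restrict, jetTwistFunHigher_fst]
    change _ = (twistHodge (twist c E) j).presheaf.map i.op
      ((dualHomTwist c E (hodgeSheaf X j)).app V (trivSection c (twistHodge E j) x hV p.fst))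
    rw [app_map_apply, trivSection_map]
    rfl
  · rw [jetTwistFunHigher_snd, TwistJetSections.snd_restrict, TwistJetSections.snd_restrict, jetTwistFunHigher_snd]
    change _ = (twistHodge (twist c E) (j + 1)).presheaf.map i.op
      ((dualHomTwist c E (hodgeSheaf X (j + 1))).app V (trivSection c (twistHodge E (j + 1)) x hV p.snd))
    rw [app_map_apply, trivSection_map]
    rfl

/-- **`J^j_x : Pʲ(E)|_W ⟶ Pʲ(E⟨c⟩)|_W`** over `W ⊆ U_x`. [cite: Atiyah1957, §4] -/
def jetTwistOverHigher : (twistJetModule E j).over W ⟶ (twistJetModule (twist c E) j).over W where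
  val := PresheafOfModules.homMk
    { app := fun V => AddCommGrpCat.ofHom
        { toFun := fun p : TwistJetSections E j V.unop.left =>
            (jetTwistFunHigher c E j x (V.unop.hom.le.trans hW) p : TwistJetSections (twist c E) j V.unop.left)
          map_zero' := jetTwistFunHigher_zero c E j x _
          map_add' := fun p q => jetTwistFunHigher_add c E j x _ p q }
      naturality := fun {V V'} i => by
        ext p
        change jetTwistFunHigher c E j x (V'.unop.hom.le.trans hW) (TwistJetSections.restrict i.unop.left p) =
          TwistJetSections.restrict i.unop.left (jetTwistFunHigher c E j x (V.unop.hom.le.trans hW) p)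
        exact jetTwistFunHigher_restrict c E j x (V.unop.hom.le.trans hW) i.unop.left p }
    (fun V (a : Γ(X.left, V.unop.left)) (p : TwistJetSections E j V.unop.left) => by
      change jetTwistFunHigher c E j x _ (a • p) = a • jetTwistFunHigher c E j x _ p
      exact jetTwistFunHigher_smul c E j x _ a p)

/-- Values of `J^j_x`. [folklore] -/
@[simp]
theorem appLE_jetTwistOverHigher {V : X.left.Opens} (k : V ⟶ W) (p : TwistJetSections E j V) :
    appLE (jetTwistOverHigher c E j x W hW) k (p : Γ(twistJetModule E j, V)) =
      (jetTwistFunHigher c E j x (k.le.trans hW) p : Γ(twistJetModule (twist c E) j, V)) := rfl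

end Jet

/-! ### The local inverse of `λ_j` over `W ⊆ U_x` -/

section Kappa

variable (x : X.left) (W : X.left.Opens) (hW : W ≤ c.U x)

/-- **`κ′_x = λ_j ∘ (– ⊗ t_x) : (E ⊗ Ωʲ)|_W ⟶ (E⟨c⟩ ⊗ Ωʲ)|_W`**: pre-composition with `t_x^* : (E⟨c⟩)^∨| → E^∨|`
(itself pre-composition with `t_x`). [folklore] -/
def dualHomLocal : (twistHodge E j).over W ⟶ (twistHodge (twist c E) j).over W :=
  precompOver (hodgeSheaf X j) (precompOver (unitModule X.left) (toTwistOver c E x W hW))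

/-- **`κ_x : (E⟨c⟩ ⊗ Ωʲ)|_W ⟶ (E ⊗ Ωʲ)|_W`**, the local inverse of `λ_j`: pre-composition with `(t_x⁻¹)^*`. [folklore] -/
def dualHomLocalInv : (twistHodge (twist c E) j).over W ⟶ (twistHodge E j).over W :=
  precompOver (hodgeSheaf X j) (precompOver (unitModule X.left) (ofTwistOver c E x W hW))

variable {A A' A'' B : X.left.Modules} in
/-- `precompOver` is contravariantly functorial. [folklore] -/
theorem precompOver_comp (t : A.over W ⟶ A'.over W) (t' : A'.over W ⟶ A''.over W) :
    precompOver B (t ≫ t') = precompOver B t' ≫ precompOver B t :=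
  hom_ext_of_appLE fun V k (ψ : A''.over V ⟶ B.over V) => by
    rw [appLE_precompOver, appLE_comp, appLE_precompOver, appLE_precompOver, restrictHom_comp, Category.assoc]

variable {A B : X.left.Modules} in
/-- `precompOver 𝟙 = 𝟙`. [folklore] -/
theorem precompOver_id : precompOver B (𝟙 (A.over W)) = 𝟙 _ :=
  hom_ext_of_appLE fun V k (ψ : A.over V ⟶ B.over V) => by
    rw [appLE_precompOver, appLE_id, restrictHom_id, Category.id_comp]

/-- `κ_x ≫ κ′_x = 𝟙`. [folklore] -/
theorem dualHomLocalInv_comp_dualHomLocal :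
    dualHomLocalInv c E j x W hW ≫ dualHomLocal c E j x W hW = 𝟙 _ := by
  rw [dualHomLocalInv, dualHomLocal, ← precompOver_comp, ← precompOver_comp, ofTwistOver_comp_toTwistOver,
    precompOver_id, precompOver_id]

/-- `κ′_x ≫ κ_x = 𝟙`. [folklore] -/
theorem dualHomLocal_comp_dualHomLocalInv :
    dualHomLocal c E j x W hW ≫ dualHomLocalInv c E j x W hW = 𝟙 _ := by
  rw [dualHomLocalInv, dualHomLocal, ← precompOver_comp, ← precompOver_comp, toTwistOver_comp_ofTwistOver,
    precompOver_id, precompOver_id]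

/-- **`κ′_x(φ) = λ_j(φ ⊗ t_x)`** on sections `φ` of `E ⊗ Ωʲ` over `V ⊆ W`. [folklore] -/
theorem appLE_dualHomLocal {V : X.left.Opens} (k : V ⟶ W) (φ : (dual E).over V ⟶ (hodgeSheaf X j).over V) :
    appLE (dualHomLocal c E j x W hW) k (φ : Γ(twistHodge E j, V)) =
      (dualHomTwist c E (hodgeSheaf X j)).app V (trivSection c (twistHodge E j) x (k.le.trans hW) φ) := by
  rw [dualHomLocal, appLE_precompOver, restrictHom_precompOver, restrictHom_toTwistOver]
  symm
  refine hom_ext_of_appLE fun V' l (μ : (twist c E).over V' ⟶ (unitModule X.left).over V') => ?_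
  rw [appLE_dualHomTwist_trivSection c E x x (k.le.trans hW) l (l.le.trans (k.le.trans hW)), c.g_self, one_smul,
    appLE_comp, appLE_precompOver, restrictHom_toTwistOver]

/-- `t_x ≫ t_y⁻¹ = g_{yx}` on `E|_W`, `W ⊆ U_x ∩ U_y`. [folklore] -/
theorem toTwistOver_comp_ofTwistOver_eq_overScalar (y : X.left) (hy : W ≤ c.U y) :
    toTwistOver c E x W hW ≫ ofTwistOver c E y W hy = overScalar E W (c.g y x W hy hW) := by
  rw [toTwistOver_eq_overScalar_comp c E x y W hW hy, Category.assoc, toTwistOver_comp_ofTwistOver,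
    Category.comp_id]

/-- **`κ_y(κ′_x(φ)) = g_{yx} φ`** (`W ⊆ U_x ∩ U_y`): the local inverses at two points differ by the transition
function. [folklore] -/
theorem dualHomLocal_comp_dualHomLocalInv_eq_overScalar (y : X.left) (hy : W ≤ c.U y) :
    dualHomLocal c E j x W hW ≫ dualHomLocalInv c E j y W hy = overScalar (twistHodge E j) W (c.g y x W hy hW) := by
  rw [dualHomLocalInv, dualHomLocal, ← precompOver_comp, ← precompOver_comp,
    toTwistOver_comp_ofTwistOver_eq_overScalar c E x W hW y hy]
  refine hom_ext_of_appLE fun V k (φ : (dual E).over V ⟶ (hodgeSheaf X j).over V) => ?_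
  rw [appLE_precompOver, appLE_overScalar, restrictHom_precompOver, restrictHom_overScalar]
  change _ = φ ≫ overScalar (hodgeSheaf X j) V (X.left.presheaf.map k.op (c.g y x W hy hW))
  refine hom_ext_of_appLE fun V' l (ν : E.over V' ⟶ (unitModule X.left).over V') => ?_
  rw [appLE_comp, appLE_precompOver, restrictHom_overScalar, overScalar_comp_eq', ← smul_overHom_def, appLE_smul']
  exact appLE_smul_right φ l _ (ν : Γ(dual E, V'))

end Kappa

end CocycleTwist

end Summit.Ventures.HSemireg

end
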